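import Summits.HodgeConjecture.HodgeConjecture.Theorems.Ring2AbelianAllStandardBWhiskers
import Summits.HodgeConjecture.HodgeConjecture.Theorems.Ring2AbelianAllStandardBKunnethProjectors
import Summits.HodgeConjecture.HodgeConjecture.Theorems.Ring2AbelianAllStandardAPencilsSquare
import Summits.HodgeConjecture.HodgeConjecture.Theorems.Ring2HypothesesDescentMotivatedOnePolarisation
import Summits.HodgeConjecture.HodgeConjecture.Theorems.Ring2HypothesesDescentMotivatedStarStable
import HarnessLib

/-!
# Ring 2 · sub-cell AbelianAll (ALL ABELIAN VARIETIES), André axis — ab-andre-1 part XV-c (ii):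
# KLEIMAN'S COROLLARY 2.5 ON THE REAL CARRIERS — André's degree-wise `B⋆` IS STABLE UNDER PRODUCTS,
# and the atlas edges `(5∀) ⟺ Sq∀`, `(5) ⟺ Sq^CM` close

HONEST FRAMING (page 1, verbatim): **research route, not a corollary; conditional on HC_CM plus one named
minimal statement.** Cell line: research route conditional on HC_CM; not a corollary; Q11.4-sentence-2
already refuted in dim ≥ 3. Nothing in this file proves an open case of the Hodge conjecture or of a standard
conjecture: `B⋆(X, η)` (`StandardConjectureBStar`, André 1996 §0.3 / Grothendieck 1968 `B(X)`) occurs only as a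
HYPOTHESIS, and `HC_CM` (`RankFourFaces.CMAbelianHodge`) does not occur at all. Seat `pub-hodge-ring2-ab-andre-1`,
gen 54. 0 `def`, 0 named fact, 0 `sorry`; standard axioms only.

## The statement (`standardConjectureBStar_tensor`)

For `X`, `Y` smooth projective over `ℂ` of dimensions `n`, `m` with polarisation classes `η_X`, `η_Y` satisfying the
tree's DEGREE-WISE `StandardConjectureBStar` ("in every degree, `⋆ : Hᵃ → H^{2n−a}` is induced by SOME algebraic
class"), `StandardConjectureBStar (n + m) (X ⊗ Y) θ` holds for EVERY class `θ ∈ H²((X × Y)(ℂ); ℂ)` — Kleiman 1968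
Cor. 2.5 ("`B(X)` and `B(Y)` imply `B(X × Y)`"), in the only-one-polarisation-needed form of seat ring2-b05's
`Ring2HypothesesDescentMotivatedOnePolarisation` (`Hypotheses.standardConjectureBStar_of_nu`: `B⋆(X, θ)` for all `θ` follows from ONE injective algebraic
`ν_k : Hᵏ → H^{2N−k}` per degree, Kleiman 1968 Prop. 2.3 / Thm. 2.9).

## The proof (no Lie theory, no graded `Λ`)

Kleiman's proof (`Λ_{X×Y} = Λ_X ⊗ 1 + 1 ⊗ Λ_Y` up to the `𝔰𝔩₂` Clebsch–Gordan bookkeeping) is replaced by the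
`ν`-criterion: the correspondence
  `ν_k := Σ_{a+b=k} σ^* ∘ [Y ◁ S_a]_* ∘ σ^* ∘ [X ◁ T_b]_* : Hᵏ(X × Y) → H^{2N−k}(X × Y)`
acts on a cross product `x_a ⊠ v_b` as `⋆_X x_a ⊠ ⋆_Y v_b` (§1), hence is INJECTIVE with inverse `ν_{2N−k}`
(`⋆⋆ = id` and the Künneth span, §1), and is algebraic as a composite of algebraic correspondences (seat ab-andre-2's
part XXII-e `IsAlgebraicCorrespondence.comp/.sum`, pull-backs `isAlgebraicCorrespondence_map`). Here `S_a` is ANY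
algebraic class acting as `⋆_X` on `Hᵃ(X)` (its action in other degrees is irrelevant after the swap `σ`), while
`T_b = S'_b ∘ π_b` is the JUNK-FREE one on `Y` (`⋆_Y` on `Hᵇ`, zero elsewhere) obtained from part XV-b's algebraic
Künneth projector `π_b` (`exists_kunnethProjector_of_standardConjectureBStar`, Kleiman's `B ⟹ C`) and part XV-a's
uniform composition (`exists_corrComp`); the WHISKER `X ◁ T` (companion file `Ring2AbelianAllStandardBWhiskers`,
part XV-c (i): the class `c • ι_* p₂₃^* T` on `(X × Y) × (X × Y)`, `ι = (X ◁ pr₁, X ◁ pr₂) : X × (Y × Y) → (X × Y)²`,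
with part XV-a's uniform base-change scalar `c`) acts as `x ⊠ v ↦ x ⊠ [T]_* v` on the typed bidegrees and kills
the others; the Koszul signs of the two swaps multiply to `(−1)^{b₁(a + a₁)} = 1`.

## Consequences (§2–§3): two atlas classes merge, and Lieberman × `B⋆`

* `(5∀) ⟺ Sq∀` (`compactAbelianPencilSquareStandardD_iff_compactAbelianPencilLefschetz`) and `(5) ⟺ Sq^CM`
  (`cmPointedPencilSquareStandardD_iff_cmPointedPencilLefschetz`): part XIV-g had only `Sq ⟹ (5)`; the converse is
  `B⋆(𝒳) ⟹ B⋆(𝒳 × 𝒳) ⟹ A(𝒳 × 𝒳, θ) ∀ θ ⟹ D(𝒳 × 𝒳) ⊗ ℂ` (§1, part XIV, part XIV-e). EDGE LABELS: derived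
  structural, fact-free, `HC_CM` absent, both sides OPEN — nothing in the census sense is closed.
* `B⋆(A × Y, θ)` for every abelian variety `A`, every `Y` with `B⋆(Y, η_Y)` and every `θ`
  (`standardConjectureBStar_abelianVariety_tensor`, Lieberman's theorem being ab-andre-2's kernel theorem
  `standardConjectureBStar_abelianVariety`); hence atlas row b05's hypothesis "`B(A × Y)` for all abelian `A` and all
  `Y`" is implied by "`B⋆(Y, η)` for all smooth projective `Y`" alone
  (`motivatedImpliesAlgebraicAV_of_forall_standardConjectureBStar`, binder-free).

References: Kleiman 1968 §2 (Prop. 2.3, Cor. 2.5, Thm. 2.9) and §1.4; Kleiman 1994 §4 (Thm. 4-1); André 1996 §0.3,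
§2.1 and Appendice (p. 44); Fulton 1998 §16.1 (correspondences) and §19.2; Fulton 1997 App. B (Gysin maps, projection
formula); Hatcher 2002 Thm. 3.15 (Künneth); Milne 2020 §6.1 (Prop. 6.1, Rem. 6.3); Lieberman 1968.
-/

noncomputable section

set_option linter.dupNamespace false

namespace Summit.HodgeConjecture.HodgeConjecture.Ring2.AbelianAll

open CategoryTheory AlgebraicGeometry MonoidalCategory CartesianMonoidalCategory
open Literature.AlgebraicGeometry Literature.AlgebraicGeometry.Motives
open Literature.AlgebraicGeometry.HodgeTheory
open Literature.AlgebraicTopology.SingularHomology (singularCohomology cupProduct)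
open Literature.Geometry.Kaehler

/-! ## §1 The operators `ν_k` of Kleiman's Prop. 2.3 on `X × Y`, from degree-wise `B⋆(X, η_X)` and `B⋆(Y, η_Y)` -/

section Nu

variable {n m : ℕ} {X Y : SchemeOver ℂ} {ηX : complexBetti X 2} {ηY : complexBetti Y 2}

/-- **ONE BIDEGREE.** Granted degree-wise `B⋆(X, η_X)`, `B⋆(Y, η_Y)`: for every bidegree `(a, b)` of `X × Y` there is
an algebraic correspondence `Φ_{a,b} : H^{a+b}(X × Y) → H^{a₁+b₁}(X × Y)` (`a + a₁ = 2n`, `b + b₁ = 2m`) acting on the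
cross products as `x_a ⊠ v_b ↦ ⋆_X x_a ⊠ ⋆_Y v_b` and KILLING every `x_i ⊠ v_j` with `j ≠ b` — the composite
`σ^* ∘ [Y ◁ S]_* ∘ σ^* ∘ [X ◁ T]_*` of whiskers (part XV-c (i) `exists_whiskerLeft_corr`) of a `⋆_X`-class `S` of `X` (junk allowed) and the junk-free
`⋆_Y`-class `T = S' ∘ π_b` of `Y` (part XV-b's Künneth projector, part XV-a's composition), the Koszul signs of the two
swaps cancelling: `(−1)^{a b₁} (−1)^{b₁ a₁} = (−1)^{2 n b₁} = 1`. [cite: Kleiman1968AlgebraicCycles, §2 Prop. 2.3 and Cor. 2.5]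
[cite: Kleiman1994StandardConjectures, §4 Thm. 4-1] [cite: Andre1996Motifs, §0.3 and §2.1] -/
theorem exists_starPiece (hX : IsSmoothProjective n X) (hY : IsSmoothProjective m Y)
    (hηX : IsPolarizationClass n X ηX) (hBX : StandardConjectureBStar n X ηX)
    (hηY : IsPolarizationClass m Y ηY) (hBY : StandardConjectureBStar m Y ηY) {a a₁ b b₁ k k' : ℕ}
    (ha : a + a₁ = 2 * n) (hb : b + b₁ = 2 * m) (hab : a + b = k) (hk' : a₁ + b₁ = k') :
    ∃ Φ : complexBetti (X ⊗ Y) k →ₗ[ℂ] complexBetti (X ⊗ Y) k',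
      IsAlgebraicCorrespondence (n + m) (n + m) (X ⊗ Y) (X ⊗ Y) Φ ∧
      (∀ (x : complexBetti X a) (v : complexBetti Y b),
        Φ (cupProduct hab (complexBetti.map (fst X Y) a x) (complexBetti.map (snd X Y) b v)) =
          cupProduct hk' (complexBetti.map (fst X Y) a₁ (lefschetzInvolution hηX.hasHardLefschetz ha x))
            (complexBetti.map (snd X Y) b₁ (lefschetzInvolution hηY.hasHardLefschetz hb v))) ∧
      (∀ {i j : ℕ} (hij : i + j = k), j ≠ b → ∀ (x : complexBetti X i) (v : complexBetti Y j),
        Φ (cupProduct hij (complexBetti.map (fst X Y) i x) (complexBetti.map (snd X Y) j v)) = 0) := by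
  have hP := hX.tensor_holds hY
  have hQ := hY.tensor_holds hX
  -- `S`: SOME algebraic class acting as `⋆_X : Hᵃ(X) → H^{a₁}(X)` (its other degrees are junk)
  obtain ⟨eX, haX, S, hS, hSeq⟩ := IsAlgebraicCorrespondence.exists_eq_corrAction hX hX (hBX hηX a a₁ ha)
  -- `T = S' ∘ π_b`: the junk-free class acting as `⋆_Y` on `Hᵇ(Y)` and as `0` on `Hʲ(Y)`, `j ≠ b`
  obtain ⟨eY, hbY, S', hS', hS'eq⟩ := IsAlgebraicCorrespondence.exists_eq_corrAction hY hY (hBY hηY b b₁ hb)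
  obtain ⟨π, hπ, hπact⟩ := exists_kunnethProjector_of_standardConjectureBStar hY hηY hBY b
  obtain ⟨T, hT, hTact⟩ := exists_corrComp complexOrientationFamily hY hY hY (rfl : eY + m = eY + m) hS' hπ
  -- the two whiskers (part XV-c (i)): `X ◁ T` on `(X × Y)²` and `Y ◁ S` on `(Y × X)²`
  obtain ⟨Γ, hΓ, hΓa, hΓb⟩ := exists_whiskerLeft_corr complexOrientationFamily hX hY hT
  obtain ⟨Γ', hΓ', hΓ'a, -⟩ := exists_whiskerLeft_corr complexOrientationFamily hY hX hS
  have hk₁ : k + 2 * (eY + n) = (a + b₁) + 2 * (n + m) := by omega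
  have hk₂ : (a + b₁) + 2 * (eX + m) = k' + 2 * (m + n) := by omega
  have hTj : ∀ {j b' : ℕ} (hjb' : j + 2 * eY = b' + 2 * m),
      corrAction complexOrientationFamily hY hY hjb' T =
        corrAction complexOrientationFamily hY hY hjb' S' ∘ₗ ((if j = b then (1 : ℂ) else 0) • LinearMap.id) :=
    fun {j b'} hjb' ↦ by rw [hTact (rfl : j + 2 * m = j + 2 * m) hjb' hjb', hπact]
  refine ⟨(complexBetti.map (lift (snd X Y) (fst X Y)) k').hom ∘ₗ
      corrAction complexOrientationFamily hQ hQ hk₂ Γ' ∘ₗ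
        (complexBetti.map (lift (snd Y X) (fst Y X)) (a + b₁)).hom ∘ₗ
          corrAction complexOrientationFamily hP hP hk₁ Γ, ?_, fun x v ↦ ?_, fun {i j} hij hjb x v ↦ ?_⟩
  · -- algebraic: composite of algebraic correspondences (part XXII-e) and pull-backs
    exact IsAlgebraicCorrespondence.comp hP hQ hP
      (IsAlgebraicCorrespondence.comp hQ hQ hP
        (IsAlgebraicCorrespondence.comp hQ hP hP
          (isAlgebraicCorrespondence_corrAction_complex hP hP hk₁ (by omega) hΓ)
          (isAlgebraicCorrespondence_map hQ hP (lift (snd Y X) (fst Y X)) (by omega)) (by omega))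
        (isAlgebraicCorrespondence_corrAction_complex hQ hQ hk₂ (by omega) hΓ') (by omega))
      (isAlgebraicCorrespondence_map hP hQ (lift (snd X Y) (fst X Y)) (by omega)) (by omega)
  · -- `x_a ⊠ v_b ↦ ⋆x ⊠ ⋆v`
    have hTv : corrAction complexOrientationFamily hY hY hbY T v = lefschetzInvolution hηY.hasHardLefschetz hb v := by
      rw [hTj hbY, LinearMap.comp_apply, if_pos rfl, one_smul, LinearMap.id_apply, ← hS'eq]
    have hsign : ((-1 : ℂ)) ^ (a * b₁ + b₁ * a₁) = 1 := by
      rw [Nat.mul_comm a b₁, ← Nat.mul_add, ha, show b₁ * (2 * n) = 2 * (b₁ * n) by ring, pow_mul,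
        neg_one_sq, one_pow]
    simp only [LinearMap.comp_apply]
    rw [hΓa hab hbY hk₁ rfl x v, hTv, map_swap_cupProduct_cross rfl (show b₁ + a = a + b₁ by omega), map_smul,
      hΓ'a (show b₁ + a = a + b₁ by omega) haX hk₂ (show b₁ + a₁ = k' by omega) _ x, ← hSeq, map_smul,
      map_swap_cupProduct_cross (show b₁ + a₁ = k' by omega) hk', smul_smul, ← pow_add, hsign, one_smul]
  · -- `x_i ⊠ v_j ↦ 0` for `j ≠ b`
    simp only [LinearMap.comp_apply]
    rcases Nat.lt_or_ge (j + 2 * eY) (2 * m) with hlt | hge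
    · rw [hΓb hij hlt hk₁ x v, map_zero, map_zero, map_zero]
    · obtain ⟨b', hb'⟩ : ∃ b', j + 2 * eY = b' + 2 * m := ⟨j + 2 * eY - 2 * m, by omega⟩
      rw [hΓa hij hb' hk₁ (by omega) x v, hTj hb', LinearMap.comp_apply, if_neg hjb, zero_smul,
        LinearMap.zero_apply, map_zero, map_zero, map_zero, map_zero, map_zero, map_zero]

/-- **KLEIMAN'S `ν`-OPERATORS ON THE PRODUCT.** Granted degree-wise `B⋆(X, η_X)` and `B⋆(Y, η_Y)`: for `k + k' = 2(n+m)`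
an algebraic correspondence `ν_k : Hᵏ(X × Y) → H^{k'}(X × Y)` acting on EVERY cross product as
`x_i ⊠ v_j ↦ ⋆_X x_i ⊠ ⋆_Y v_j` — the sum over `a` of the pieces `Φ_{a, k−a}` of `exists_starPiece`.
[cite: Kleiman1968AlgebraicCycles, §2 Prop. 2.3, Cor. 2.5 and Thm. 2.9] [cite: Kleiman1994StandardConjectures, §4 Thm. 4-1] -/
theorem exists_nu_tensor (hX : IsSmoothProjective n X) (hY : IsSmoothProjective m Y)
    (hηX : IsPolarizationClass n X ηX) (hBX : StandardConjectureBStar n X ηX)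
    (hηY : IsPolarizationClass m Y ηY) (hBY : StandardConjectureBStar m Y ηY) {k k' : ℕ}
    (hkk' : k + k' = 2 * (n + m)) :
    ∃ F : complexBetti (X ⊗ Y) k →ₗ[ℂ] complexBetti (X ⊗ Y) k',
      IsAlgebraicCorrespondence (n + m) (n + m) (X ⊗ Y) (X ⊗ Y) F ∧
      ∀ {i j i₁ j₁ : ℕ} (hij : i + j = k) (hi : i + i₁ = 2 * n) (hj : j + j₁ = 2 * m) (hij₁ : i₁ + j₁ = k')
        (x : complexBetti X i) (v : complexBetti Y j),
        F (cupProduct hij (complexBetti.map (fst X Y) i x) (complexBetti.map (snd X Y) j v)) =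
          cupProduct hij₁ (complexBetti.map (fst X Y) i₁ (lefschetzInvolution hηX.hasHardLefschetz hi x))
            (complexBetti.map (snd X Y) j₁ (lefschetzInvolution hηY.hasHardLefschetz hj v)) := by
  have hP := hX.tensor_holds hY
  -- one piece per index `a`; the zero map when `(a, k − a)` is not a bidegree of `X × Y`
  have piece : ∀ a : ℕ, ∃ Φ : complexBetti (X ⊗ Y) k →ₗ[ℂ] complexBetti (X ⊗ Y) k',
      IsAlgebraicCorrespondence (n + m) (n + m) (X ⊗ Y) (X ⊗ Y) Φ ∧
      (∀ {a₁ b b₁ : ℕ} (ha : a + a₁ = 2 * n) (hb : b + b₁ = 2 * m) (hab : a + b = k) (hk' : a₁ + b₁ = k')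
          (x : complexBetti X a) (v : complexBetti Y b),
        Φ (cupProduct hab (complexBetti.map (fst X Y) a x) (complexBetti.map (snd X Y) b v)) =
          cupProduct hk' (complexBetti.map (fst X Y) a₁ (lefschetzInvolution hηX.hasHardLefschetz ha x))
            (complexBetti.map (snd X Y) b₁ (lefschetzInvolution hηY.hasHardLefschetz hb v))) ∧
      (∀ {i j : ℕ} (hij : i + j = k), i ≠ a → i ≤ 2 * n → j ≤ 2 * m →
        ∀ (x : complexBetti X i) (v : complexBetti Y j),
          Φ (cupProduct hij (complexBetti.map (fst X Y) i x) (complexBetti.map (snd X Y) j v)) = 0) := by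
    intro a
    by_cases hval : a ≤ 2 * n ∧ a ≤ k ∧ k ≤ a + 2 * m
    · obtain ⟨Φ, hΦ, h1, h2⟩ := exists_starPiece hX hY hηX hBX hηY hBY
        (show a + (2 * n - a) = 2 * n by omega) (show (k - a) + (2 * m - (k - a)) = 2 * m by omega)
        (show a + (k - a) = k by omega) (show (2 * n - a) + (2 * m - (k - a)) = k' by omega)
      refine ⟨Φ, hΦ, fun {a₁ b b₁} ha hb hab hk' x v ↦ ?_, fun {i j} hij hia _ _ x v ↦ h2 hij (by omega) x v⟩
      obtain rfl : a₁ = 2 * n - a := by omega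
      obtain rfl : b = k - a := by omega
      obtain rfl : b₁ = 2 * m - (k - a) := by omega
      exact h1 x v
    · refine ⟨0, isAlgebraicCorrespondence_zero hP hP (show k + 2 * k' = k' + 2 * (n + m) by omega) (by omega),
        fun {a₁ b b₁} ha hb hab hk' x v ↦ ?_, fun _ _ _ _ _ _ ↦ LinearMap.zero_apply _⟩
      rw [LinearMap.zero_apply]
      rcases Nat.lt_or_ge (2 * n) a with h | h
      · haveI := subsingleton_complexBetti hX h
        simp only [Subsingleton.elim x 0, map_zero, LinearMap.zero_apply]
      · haveI := subsingleton_complexBetti hY (show 2 * m < b by omega)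
        simp only [Subsingleton.elim v 0, map_zero]
  choose Φ hΦ hΦ₁ hΦ₀ using piece
  refine ⟨∑ a ∈ Finset.range (k + 1), Φ a, ?_, fun {i j i₁ j₁} hij hi hj hij₁ x v ↦ ?_⟩
  · simpa only [one_smul] using
      IsAlgebraicCorrespondence.sum hP hP (Finset.range (k + 1)) (fun _ ↦ (1 : ℂ)) Φ hΦ 0
  · rw [LinearMap.sum_apply, Finset.sum_eq_single i, hΦ₁ i hi hj hij hij₁ x v]
    · intro a _ hai
      exact hΦ₀ a hij (Ne.symm hai) (by omega) (by omega) x v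
    · intro hi'
      exact absurd (Finset.mem_range.2 (by omega)) hi'

/-- **`ν_k` IS INJECTIVE** (indeed `ν_{k'} ∘ ν_k = id`: `⋆⋆ = id` on both factors and the Künneth span).
[cite: Kleiman1968AlgebraicCycles, §2 Prop. 2.3 and Cor. 2.5] [cite: HatcherAT2002, Thm. 3.15 (Künneth)] -/
theorem exists_nu_tensor_injective (hX : IsSmoothProjective n X) (hY : IsSmoothProjective m Y)
    (hηX : IsPolarizationClass n X ηX) (hBX : StandardConjectureBStar n X ηX)
    (hηY : IsPolarizationClass m Y ηY) (hBY : StandardConjectureBStar m Y ηY) {k k' : ℕ}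
    (hkk' : k + k' = 2 * (n + m)) :
    ∃ F : complexBetti (X ⊗ Y) k →ₗ[ℂ] complexBetti (X ⊗ Y) k',
      IsAlgebraicCorrespondence (n + m) (n + m) (X ⊗ Y) (X ⊗ Y) F ∧ Function.Injective F := by
  obtain ⟨F, hF, hFx⟩ := exists_nu_tensor hX hY hηX hBX hηY hBY hkk'
  obtain ⟨G, -, hGx⟩ := exists_nu_tensor hX hY hηX hBX hηY hBY (show k' + k = 2 * (n + m) by omega)
  refine ⟨F, hF, Function.HasLeftInverse.injective ⟨G, fun z ↦ ?_⟩⟩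
  change (G ∘ₗ F) z = (LinearMap.id : complexBetti (X ⊗ Y) k →ₗ[ℂ] complexBetti (X ⊗ Y) k) z
  refine LinearMap.eqOn_span (f := G ∘ₗ F) (g := LinearMap.id) ?_ (kunnethSpan_complexBetti hX hY k z)
  rintro _ ⟨i, j, hij, x, v, rfl⟩
  simp only [LinearMap.comp_apply, LinearMap.id_apply]
  rcases Nat.lt_or_ge (2 * n) i with hi | hi
  · haveI := subsingleton_complexBetti hX hi
    simp only [Subsingleton.elim x 0, map_zero, LinearMap.zero_apply]
  rcases Nat.lt_or_ge (2 * m) j with hj | hj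
  · haveI := subsingleton_complexBetti hY hj
    simp only [Subsingleton.elim v 0, map_zero]
  rw [hFx hij (show i + (2 * n - i) = 2 * n by omega) (show j + (2 * m - j) = 2 * m by omega) (by omega) x v,
    hGx (show (2 * n - i) + (2 * m - j) = k' by omega) (show (2 * n - i) + i = 2 * n by omega)
      (show (2 * m - j) + j = 2 * m by omega) hij,
    Theorems.lefschetzInvolution_lefschetzInvolution_eq, Theorems.lefschetzInvolution_lefschetzInvolution_eq]

/-- **KLEIMAN 1968, COROLLARY 2.5, ON THE REAL CARRIERS: `B⋆` IS STABLE UNDER PRODUCTS.** Degree-wise `B⋆(X, η_X)` and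
`B⋆(Y, η_Y)` for polarisation classes `η_X`, `η_Y` give `StandardConjectureBStar (n + m) (X ⊗ Y) θ` for EVERY class `θ`
(André's form: `⋆_{L_θ}` is an algebraic correspondence of `X × Y` in every degree, for every polarisation `θ` of the
product — not only `η_X ⊠ 1 + 1 ⊠ η_Y`), through ring2-b05's `ν`-criterion `Hypotheses.standardConjectureBStar_of_nu`
(Kleiman Prop. 2.3 `(ν) ⟹ B`, Thm. 2.9). Both hypotheses OPEN in general; nothing asserted.
[cite: Kleiman1968AlgebraicCycles, §2 Cor. 2.5, Prop. 2.3 and Thm. 2.9] [cite: Kleiman1994StandardConjectures, §4 Thm. 4-1 (3)]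
[cite: Andre1996Motifs, §0.3] -/
theorem standardConjectureBStar_tensor (hX : IsSmoothProjective n X) (hY : IsSmoothProjective m Y)
    (hηX : IsPolarizationClass n X ηX) (hBX : StandardConjectureBStar n X ηX)
    (hηY : IsPolarizationClass m Y ηY) (hBY : StandardConjectureBStar m Y ηY) (θ : complexBetti (X ⊗ Y) 2) :
    StandardConjectureBStar (n + m) (X ⊗ Y) θ :=
  Hypotheses.standardConjectureBStar_of_nu (hX.tensor_holds hY)
    (fun b r _ hbr _ ↦ exists_nu_tensor_injective hX hY hηX hBX hηY hBY
      (show b + 2 * r + b = 2 * (n + m) by omega)) θ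

/-- The all-polarisations form: `(∀ η, B⋆(X, η)) ∧ (∀ η, B⋆(Y, η)) ⟹ ∀ θ, B⋆(X × Y, θ)` (a polarisation class exists
on each factor, `Hypotheses.exists_isPolarizationClass_of_isSmoothProjective`). [cite: Kleiman1968AlgebraicCycles, §2 Cor. 2.5] -/
theorem standardConjectureBStar_tensor_of_forall (hX : IsSmoothProjective n X) (hY : IsSmoothProjective m Y)
    (hBX : ∀ η : complexBetti X 2, StandardConjectureBStar n X η)
    (hBY : ∀ η : complexBetti Y 2, StandardConjectureBStar m Y η) (θ : complexBetti (X ⊗ Y) 2) :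
    StandardConjectureBStar (n + m) (X ⊗ Y) θ := by
  obtain ⟨ηX', hηX'⟩ := Hypotheses.exists_isPolarizationClass_of_isSmoothProjective hX
  obtain ⟨ηY', hηY'⟩ := Hypotheses.exists_isPolarizationClass_of_isSmoothProjective hY
  exact standardConjectureBStar_tensor hX hY hηX' (hBX ηX') hηY' (hBY ηY') θ

end Nu

/-! ## §2 Lieberman × `B⋆(Y)`: atlas row b05's hypothesis from `B⋆` of the second factor alone -/

section Abelian

variable {m : ℕ} {Y : SchemeOver ℂ} {ηY : complexBetti Y 2}

/-- **`B⋆(A × Y, θ)` for every complex abelian variety `A`**, every smooth projective `Y` with degree-wise `B⋆(Y, η_Y)`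
and every `θ`: Lieberman's theorem `B(A)` is ab-andre-2's kernel theorem `standardConjectureBStar_abelianVariety`
(part "LiebermanHolds"), and `B⋆` is stable under products (§1). [cite: Lieberman1968, main theorem]
[cite: Kleiman1968AlgebraicCycles, §2 Cor. 2.5 and remark after Thm. 2.9 (abelian varieties)] -/
theorem standardConjectureBStar_abelianVariety_tensor (A : AbelianVariety ℂ) (hY : IsSmoothProjective m Y)
    (hηY : IsPolarizationClass m Y ηY) (hBY : StandardConjectureBStar m Y ηY) (θ : complexBetti (A.X ⊗ Y) 2) :
    StandardConjectureBStar (A.dim + m) (A.X ⊗ Y) θ := by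
  obtain ⟨η₀, hη₀⟩ :=
    Hypotheses.exists_isPolarizationClass_of_isSmoothProjective (AbelianVariety.isSmoothProjective_holds (A := A))
  exact standardConjectureBStar_tensor (AbelianVariety.isSmoothProjective_holds (A := A)) hY hη₀
    (standardConjectureBStar_abelianVariety A η₀) hηY hBY θ

/-- **Row b05's hypothesis "`B(A × Y)` for all abelian `A` and all `Y`" follows from "`B⋆(Y, η)` for all smooth
projective `Y`" alone**; hence André's "motivated ⟹ algebraic on abelian varieties"
(`Hypotheses.MotivatedImpliesAlgebraicAV`) from the latter (ring2-b05's
`Hypotheses.motivatedImpliesAlgebraicAV_of_standardConjectureBStar_abelian_tensor`). Binder-free; `HC_CM` absent; the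
hypothesis is Grothendieck's standard conjecture `B` for all complex varieties (OPEN) — nothing asserted.
[cite: Andre1996Motifs, §0.4, §2.1 and Scholie 0.6.1] [cite: Kleiman1968AlgebraicCycles, §2 Cor. 2.5] [cite: Lieberman1968, main theorem] -/
theorem motivatedImpliesAlgebraicAV_of_forall_standardConjectureBStar
    (hB : ∀ (m : ℕ) (Y : SchemeOver ℂ), IsSmoothProjective m Y →
      ∀ η : complexBetti Y 2, StandardConjectureBStar m Y η) :
    Hypotheses.MotivatedImpliesAlgebraicAV :=
  Hypotheses.motivatedImpliesAlgebraicAV_of_standardConjectureBStar_abelian_tensor fun A m Y θ hY ↦ by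
    obtain ⟨η, hη⟩ := Hypotheses.exists_isPolarizationClass_of_isSmoothProjective hY
    exact standardConjectureBStar_abelianVariety_tensor A hY hη (hB m Y hY η) θ

end Abelian

/-! ## §3 The atlas edges close: `(5∀) ⟺ Sq∀` and `(5) ⟺ Sq^CM` -/

/-- **`(5∀) ⟹ Sq∀`** (converse of part XIV-g's `compactAbelianPencilLefschetz_of_squareStandardD`): `B⋆(𝒳, η)` for
all `η` on every compact abelian pencil total space gives `B⋆(𝒳 × 𝒳, θ)` for all `θ` (§1), hence `A(𝒳 × 𝒳, θ)` for
every polarisation class `θ` (part XIV, Grothendieck's `B ⟹ A`), i.e. `D(𝒳 × 𝒳) ⊗ ℂ` (part XIV-g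
`compactAbelianPencilSquareStandardD_iff_standardConjectureA_square`). Fact-free; both sides OPEN.
[cite: Kleiman1968AlgebraicCycles, §2 Cor. 2.5 and §3 Cor. 3.9] [cite: Milne2020LefschetzStandardFiniteFields, §6.1 Prop. 6.1 and Rem. 6.3] -/
theorem compactAbelianPencilSquareStandardD_of_compactAbelianPencilLefschetz (h₅ : CompactAbelianPencilLefschetz) :
    CompactAbelianPencilSquareStandardD :=
  compactAbelianPencilSquareStandardD_iff_standardConjectureA_square.2 fun _ _ _ f hf θ hθ ↦
    standardConjectureA_of_standardConjectureBStar
      (hf.isSmoothProjective_total.tensor_holds hf.isSmoothProjective_total) hθ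
      (standardConjectureBStar_tensor_of_forall hf.isSmoothProjective_total hf.isSmoothProjective_total
        (h₅ f hf) (h₅ f hf) θ)

/-- **Sq∀ ⟺ (5∀)**: the atlas nodes `CompactAbelianPencilSquareStandardD` (part XIV-g) and
`CompactAbelianPencilLefschetz` (part I) coincide. Fact-free, `HC_CM` absent, both OPEN; an EQUIVALENCE of hypotheses,
no case of either is proved. [cite: Kleiman1968AlgebraicCycles, §2 Cor. 2.5, §3 Thm. 3.5 and Cor. 3.9]
[cite: Milne2020LefschetzStandardFiniteFields, §6.1 Rem. 6.3] -/
theorem compactAbelianPencilSquareStandardD_iff_compactAbelianPencilLefschetz :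
    CompactAbelianPencilSquareStandardD ↔ CompactAbelianPencilLefschetz :=
  ⟨compactAbelianPencilLefschetz_of_squareStandardD,
    compactAbelianPencilSquareStandardD_of_compactAbelianPencilLefschetz⟩

/-- **`(5) ⟹ Sq^CM`** (converse of part XIV-g's `cmPointedPencilLefschetz_of_squareStandardD`), by the same three
steps on the CM-pointed compact pencils (part XIV-e `standardConjectureA_forall_iff_nondegenerate` on `𝒳 × 𝒳`).
Fact-free; both sides OPEN. [cite: Kleiman1968AlgebraicCycles, §2 Cor. 2.5 and §3 Cor. 3.9]
[cite: Andre1996Motifs, Lemme 6.3.1 (ii) (p. 31)] -/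
theorem cmPointedPencilSquareStandardD_of_cmPointedPencilLefschetz (h₅ : CMPointedPencilLefschetz) :
    CMPointedPencilSquareStandardD := fun _ _ _ f hf hCM ↦
  (standardConjectureA_forall_iff_nondegenerate
      (hf.isSmoothProjective_total.tensor_holds hf.isSmoothProjective_total)).1 fun θ hθ ↦
    standardConjectureA_of_standardConjectureBStar
      (hf.isSmoothProjective_total.tensor_holds hf.isSmoothProjective_total) hθ
      (standardConjectureBStar_tensor_of_forall hf.isSmoothProjective_total hf.isSmoothProjective_total
        (h₅ f hf hCM) (h₅ f hf hCM) θ)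

/-- **Sq^CM ⟺ (5)**: `CMPointedPencilSquareStandardD` (part XIV-g) and `CMPointedPencilLefschetz` (part I) coincide.
Fact-free, `HC_CM` absent, both OPEN. [cite: Kleiman1968AlgebraicCycles, §2 Cor. 2.5 and §3 Cor. 3.9]
[cite: Milne2020LefschetzStandardFiniteFields, §6.1 Rem. 6.3] -/
theorem cmPointedPencilSquareStandardD_iff_cmPointedPencilLefschetz :
    CMPointedPencilSquareStandardD ↔ CMPointedPencilLefschetz :=
  ⟨cmPointedPencilLefschetz_of_squareStandardD, cmPointedPencilSquareStandardD_of_cmPointedPencilLefschetz⟩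

end Summit.HodgeConjecture.HodgeConjecture.Ring2.AbelianAll

end
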